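import Summits.Ventures.QEC.Census.CertCoverBatch
import Summits.Ventures.QEC.Census.BB.A1s_n192_k8_a80d8cc5.L1Iface
import HarnessLib

set_option Elab.async false
set_option maxRecDepth 200000

/-!
# `[[192,8,16]]` one-level cover certificate of `A1s_n192_k8_a80d8cc5` — WITNESS TABLE round trip, part A: `orbCheckAux ePermqs eTr eInv 48` on representative chunks 0–1
(≤ 80 representatives × 48 translations each; type-12 lockstep `permWordL`; qec-type-10 `CertCoverBatch.orbCheck`). Data (chunk lists) + decided checks; KERNEL. qec-search-1 g5.
-/

namespace Summit.Ventures.QEC.Census.A1s_n192_k8_a80d8cc5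

open Matrix Summit.Ventures.QEC.Census Literature.InformationTheory.QuantumCodes

/-- Representatives 0–79. -/
def repsC0 : List ℕ :=
  [
    0x501010830318001, 0x1000030000001010800, 0x100a04240098400008e, 0x10189044004040041c8,
    0x1080018800840088400, 0x10c000c400c600c4200, 0x1100060001082121000, 0x13000c0003184342000,
    0x3000050000003031800, 0x50000f0000005052800, 0x5062420001010000f20, 0x51000a0001086163000,
    0x5200050002103231800, 0x7000090000007073800, 0x71000c0001084142000, 0x7200030002101210800,
    0x90001b0000009094800, 0x908019880084800c400, 0x92308000622008c2000, 0xb100180001088184000,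
    0xb900300009490808000, 0xd400030004201410800, 0x11000330000011118800, 0x11000631010821200801,
    0x11080318800850180400, 0x11100360001092029000, 0x11801080060804301840, 0x13100300001090008000,
    0x15300300003190208000, 0x19800030008401810800, 0x1b10028000109808c000, 0x21000630000021200800,
    0x2100a4003e004000a004, 0x2104082001200a1201c0, 0x21421000026020081e00, 0x23000650000023221800,
    0x230408400120081011c0, 0x23100301011890008001, 0x231006000010a0310000, 0x23100c020200c0520002,
    0x253006000031a0110000, 0x27200630002121000800, 0x2920480040802010060c, 0x31000031010801010801,
    0x31000530000031308800, 0x31080019810040088401, 0x331005000010b0218000, 0x41000632021021200802,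
    0x41000c30000041430800, 0x41080c188008004a8400, 0x41100c600010c2501000, 0x43000c50000043411800,
    0x431006020200a0310002, 0x43100c000010c0520000, 0x43101804043000940004, 0x49231004020280082004,
    0x61000a30000061620800, 0x61100062020082121002, 0x73100302020090008002, 0x81001830000081850800,
    0x81101860001002961000, 0x83101800001000940000, 0x85301800003100b40000, 0x871018c0001004902000,
    0x89231000062280082000, 0x93101b00001010848000, 0x9b901800009400140000, 0xc3101400001040d60000,
    0xe3101802020000940002, 0x101003030000101090801, 0x101006020108201110812, 0x101083018800940008401,
    0x103101808085000940008, 0x103103000001180180001, 0x103106010109280000012, 0x105303000003080380001,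
    0x121280100080078800180, 0x181080010884840088408, 0x1831028000011009c0001, 0x201006030000201110802]

set_option maxHeartbeats 400000000 in
/-- Round trip on chunk 0 (80 representatives × 48 translations). -/
theorem orbChk0 : orbCheckAux A1s_n192_k8_a80d8cc5.ePermqs eTr eInv 48 repsC0 = true := by decide +kernel

/-- Representatives 80–108. -/
def repsC1 : List ℕ :=
  [
    0x20100c010210401210824, 0x201020a84202018150000, 0x201106060001282021002, 0x209100842800c00080058,
    0x20f506000005080400002, 0x211020984202008058000, 0x2190208042020000dc000, 0x221021020c10081020006,
    0x241400200101070100301, 0x251400100101060008301, 0x263106002020280000000, 0x401006010210201110822,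
    0x40100c030000401210804, 0x4010120020201844000c6, 0x403106020211280000022, 0x4113010840008810000b0,
    0x42100c630000421000804, 0x801012042400184400086, 0x801018030000801410808, 0x801098018800040488408,
    0x803130080840080900090, 0x8094a4b08000010030000, 0x8194a4808000000138000, 0x1001030030001001810810,
    0x1001060130082000010921, 0x1013130300000090808010, 0x1301030020109001810800, 0x402b425840020000080002,
    0x404b425842001000080000]

set_option maxHeartbeats 400000000 in
/-- Round trip on chunk 1 (29 representatives × 48 translations). -/
theorem orbChk1 : orbCheckAux A1s_n192_k8_a80d8cc5.ePermqs eTr eInv 48 repsC1 = true := by decide +kernel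


end Summit.Ventures.QEC.Census.A1s_n192_k8_a80d8cc5
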